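import Mathlib
import Literature.Analysis.FluidPDE.LocalTypeILscPressure
import Literature.Analysis.FluidPDE.LocalTypeIProofs
import HarnessLib

/-!
# `∫ |p|^{3/2}` over a sub-cylinder passes to weak `L^{3/2}` limits
# (support item `EulerZoomLiouville.SereginZoomReduction` = stmt-NavierStokesRegularity-19834)

Route `EulerZoomLiouville` (NavierStokesRegularity), support item Z = Seregin's Euler-zoom theorem.  The `D`-gauge of
the Euler limit is obtained from the uniform `D`-bounds of the zoomed pressures by weak lower semicontinuity of the
`L^{3/2}` mass on every sub-cylinder: the plain (non-oscillation) twin of the tree's `cknDOsc_le_of_tendsto_weakly`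
(Albritton–Barker 2019 §3, "(3.6) follows from (3.3)"), by the same duality argument — test against
`g = 1_T p/√|p| ∈ L³`, `∫_T |p|^{3/2} = lim ∫_T q_k g ≤ B^{2/3} (∫_T |p|^{3/2})^{1/3}`.

* `setLIntegral_threeHalves_le_of_tendsto_weakly` — if `q_k ⇀ p` weakly in `L^{3/2}(Q₀)` (tested against `L³(Q₀)`),
  `p ∈ L^{3/2}(Q₀)`, `T ⊆ Q₀` measurable and `∫_T |q_k|^{3/2} ≤ B` for all `k`, then `∫_T |p|^{3/2} ≤ B`.

WHAT THIS IS NOT: not NS regularity; a measure-theory helper `--supports` stmt-19834. [folklore]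
-/

noncomputable section

set_option linter.dupNamespace false

open MeasureTheory TopologicalSpace Set Function Filter Topology Metric
open scoped NNReal ENNReal

namespace Summit.NavierStokesRegularity.NavierStokesRegularity.Theorems.SereginZoomReduction

open Literature.Analysis Literature.Analysis.FluidPDE Literature.Analysis.FunctionSpaces

/-- **`∫_T |p|^{3/2}` passes to weak `L^{3/2}` limits.**  On a set `Q₀ ⊆ ℝ × ℝ³`, let
`q_k ⇀ p` weakly in `L^{3/2}(Q₀)` in the sense that `∫_{Q₀} q_k g → ∫_{Q₀} p g` for every `g ∈ L³(Q₀)`, with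
`q_k, p ∈ L^{3/2}(Q₀)`; if `T ⊆ Q₀` is measurable and `∫_T |q_k|^{3/2} ≤ B` for all `k`, then `∫_T |p|^{3/2} ≤ B`.
[folklore] -/
theorem setLIntegral_threeHalves_le_of_tendsto_weakly {Q₀ T : Set (ℝ × EuclideanSpace ℝ (Fin 3))}
    (hT : MeasurableSet T) (hTQ : T ⊆ Q₀)
    {q : ℕ → ℝ → EuclideanSpace ℝ (Fin 3) → ℝ} {p : ℝ → EuclideanSpace ℝ (Fin 3) → ℝ} {B : ℝ≥0∞}
    (hq : ∀ k, MemLp (uncurry (q k)) (3 / 2) (volume.restrict Q₀))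
    (hp : MemLp (uncurry p) (3 / 2) (volume.restrict Q₀))
    (hconv : ∀ g : ℝ × EuclideanSpace ℝ (Fin 3) → ℝ, MemLp g 3 (volume.restrict Q₀) →
      Tendsto (fun k => ∫ w in Q₀, q k w.1 w.2 * g w) atTop (𝓝 (∫ w in Q₀, p w.1 w.2 * g w)))
    (hbound : ∀ k, ∫⁻ w in T, ‖q k w.1 w.2‖ₑ ^ (3 / 2 : ℝ) ≤ B) :
    ∫⁻ w in T, ‖p w.1 w.2‖ₑ ^ (3 / 2 : ℝ) ≤ B := by
  rcases eq_or_ne B ⊤ with rfl | hBtop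
  · exact le_top
  haveI : ENNReal.HolderTriple (3 / 2 : ℝ≥0∞) 3 1 := holderTriple_threeHalves_three_one'
  set μ' : Measure (ℝ × EuclideanSpace ℝ (Fin 3)) := volume.restrict T with hμ'
  have hμle : μ' ≤ volume.restrict Q₀ := Measure.restrict_mono hTQ le_rfl
  obtain ⟨h32, h32', h32r⟩ := threeHalves_facts
  have h320 : (3 / 2 : ℝ≥0∞) ≠ 0 := (zero_lt_one.trans_le h32).ne'
  -- restrictions to `T`
  have hq' : ∀ k, MemLp (uncurry (q k)) (3 / 2) μ' := fun k => MemLp.mono_measure hμle (hq k)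
  have hp' : MemLp (uncurry p) (3 / 2) μ' := MemLp.mono_measure hμle hp
  set P := fun w : ℝ × EuclideanSpace ℝ (Fin 3) => p w.1 w.2 with hPdef
  have hPmem : MemLp P (3 / 2) μ' := hp'
  set N := ∫⁻ w, ‖P w‖ₑ ^ (3 / 2 : ℝ) ∂μ' with hN
  have hNtop : N ≠ ∞ := by
    have h := hPmem.eLpNorm_lt_top
    rw [eLpNorm_eq_lintegral_rpow_enorm_toReal h320 h32', h32r] at h
    exact ((ENNReal.rpow_lt_top_iff_of_pos (by norm_num)).1 h).ne
  -- the test function `g = P / √|P|`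
  set g : ℝ × EuclideanSpace ℝ (Fin 3) → ℝ := fun w => P w / Real.sqrt |P w| with hgdef
  have hgm : AEStronglyMeasurable g μ' :=
    (hPmem.1.aemeasurable.div
      (continuous_abs.measurable.comp_aemeasurable hPmem.1.aemeasurable).sqrt).aestronglyMeasurable
  have hg3 : ∫⁻ w, ‖g w‖ₑ ^ (3 : ℝ) ∂μ' = N :=
    lintegral_congr fun w => enorm_div_sqrt_abs_rpow_three _
  have hgmem : MemLp g 3 μ' := by
    refine ⟨hgm, ?_⟩
    rw [eLpNorm_eq_lintegral_rpow_enorm_toReal (by norm_num) (by norm_num), ENNReal.toReal_ofNat,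
      hg3]
    exact ENNReal.rpow_lt_top_of_nonneg (by norm_num) hNtop
  -- Step A: `∫ P g = N`
  have hA : ENNReal.ofReal (∫ w, P w * g w ∂μ') = N := by
    have hPg : ∀ w, P w * g w = |P w| ^ (3 / 2 : ℝ) := fun w => mul_div_sqrt_abs_eq_rpow (P w)
    have hint : Integrable (fun w => P w * g w) μ' := hPmem.integrable_mul hgmem
    have hnn : 0 ≤ᵐ[μ'] fun w => P w * g w :=
      Eventually.of_forall fun w => by simp only [Pi.zero_apply]; rw [hPg]; positivity
    rw [ofReal_integral_eq_lintegral_ofReal hint hnn]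
    refine lintegral_congr fun w => ?_
    rw [hPg, ← ENNReal.ofReal_rpow_of_nonneg (abs_nonneg _) (by norm_num),
      ← Real.enorm_eq_ofReal_abs]
  -- Step B: Hölder bound on the approximants
  have hB : ∀ k, ‖∫ w, q k w.1 w.2 * g w ∂μ'‖ₑ ≤ B ^ (2 / 3 : ℝ) * N ^ (1 / 3 : ℝ) := by
    intro k
    refine (enorm_integral_le_lintegral_enorm _).trans ?_
    have hH := ENNReal.lintegral_mul_le_Lp_mul_Lq μ'
      (Real.holderConjugate_iff.2 ⟨by norm_num, by norm_num⟩ : (3 / 2 : ℝ).HolderConjugate 3)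
      (hq' k).1.aemeasurable.enorm hgm.aemeasurable.enorm
    simp only [Pi.mul_apply] at hH
    calc ∫⁻ w, ‖q k w.1 w.2 * g w‖ₑ ∂μ' = ∫⁻ w, ‖uncurry (q k) w‖ₑ * ‖g w‖ₑ ∂μ' := by
          simp_rw [enorm_mul]; rfl
      _ ≤ (∫⁻ w, ‖uncurry (q k) w‖ₑ ^ (3 / 2 : ℝ) ∂μ') ^ (1 / (3 / 2 : ℝ)) *
            (∫⁻ w, ‖g w‖ₑ ^ (3 : ℝ) ∂μ') ^ (1 / (3 : ℝ)) := hH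
      _ ≤ B ^ (2 / 3 : ℝ) * N ^ (1 / 3 : ℝ) := by
          rw [hg3, show (1 / (3 / 2 : ℝ)) = 2 / 3 by norm_num]
          gcongr
          exact hbound k
  -- Step C: weak convergence tested against `g` on `T`
  have hC : Tendsto (fun k => ∫ w, q k w.1 w.2 * g w ∂μ') atTop (𝓝 (∫ w, P w * g w ∂μ')) :=
    SuitableCompactness.tendsto_setIntegral_mul_of_subset hT hTQ (f := fun k w => q k w.1 w.2)
      (g := fun w => p w.1 w.2) hconv g hgmem
  -- Step D: pass to the limit in the Hölder bound
  have hDlim : N ≤ B ^ (2 / 3 : ℝ) * N ^ (1 / 3 : ℝ) :=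
    calc N = ENNReal.ofReal (∫ w, P w * g w ∂μ') := hA.symm
      _ ≤ ‖∫ w, P w * g w ∂μ'‖ₑ := Real.ofReal_le_enorm _
      _ ≤ B ^ (2 / 3 : ℝ) * N ^ (1 / 3 : ℝ) := le_of_tendsto' hC.enorm hB
  -- Step E: `N ≤ B`
  rcases eq_or_ne N 0 with hN0 | hN0
  · rw [hN0]; exact zero_le
  have h1 : N ^ (2 / 3 : ℝ) ≤ B ^ (2 / 3 : ℝ) := by
    have h13 : N ^ (1 / 3 : ℝ) ≠ 0 := by
      intro h
      rcases ENNReal.rpow_eq_zero_iff.1 h with ⟨h0, -⟩ | ⟨-, hneg⟩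
      · exact hN0 h0
      · norm_num at hneg
    have h13' : N ^ (1 / 3 : ℝ) ≠ ∞ := ENNReal.rpow_ne_top_of_nonneg (by norm_num) hNtop
    have e : N ^ (2 / 3 : ℝ) * N ^ (1 / 3 : ℝ) = N := by
      rw [← ENNReal.rpow_add _ _ hN0 hNtop]; norm_num
    rw [← ENNReal.mul_le_mul_iff_left h13 h13', e]
    exact hDlim
  have := ENNReal.rpow_le_rpow h1 (by norm_num : (0 : ℝ) ≤ 3 / 2)
  rwa [← ENNReal.rpow_mul, ← ENNReal.rpow_mul, show (2 / 3 : ℝ) * (3 / 2) = 1 by norm_num,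
    ENNReal.rpow_one, ENNReal.rpow_one] at this

end Summit.NavierStokesRegularity.NavierStokesRegularity.Theorems.SereginZoomReduction
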